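import Literature.MathematicalPhysics.StatisticalMechanics.HcpFccLatticeSumsLayers
import Literature.MathematicalPhysics.StatisticalMechanics.BarlowStacking
import Literature.MathematicalPhysics.StatisticalMechanics.Crystallization

/-!
# The energies per particle of hcp and fcc as explicit lattice series

For `a, h ≠ 0` and any pair potential `V`, the energy per particle
(`PeriodicConfiguration.energyPerParticle`, Blanc–Lewin 2015 (23)) of the Barlow configurations
`fccPeriodicConfiguration ha hh` and `hcpPeriodicConfiguration ha hh` (`BarlowStacking.lean`) is the
`ℤ³`-indexed series `½ ∑_{v ≠ 0} V(√(a² form(v) + k² h²))` with `form = fccForm` (one motif point;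
`|Φ(k,i,j)|² = a²(i² + ij + j² + ik + jk + k²/3) + k²h²`, label `L(k) = k`) resp. `hcpForm` (two
motif points with the same site sum, by the point reflection `y ↦ b − y`; same bookkeeping as the
tree's Summits-side `hcpEnergySeries_of_eq`, re-proved here in Literature for general `V` and both
stackings).  For `V = V_LJ` and `h = a c` this gives
`e = ½ ((1/12) a⁻¹² L₁₂(c) − (1/6) a⁻⁶ L₆(c))` with the inverse-power sums of
`HcpFccLatticeSums.lean` (`fcc/hcp_lennardJones_energyPerParticle`, for all `a, c ≠ 0`).

Also: injectivity of the point map `(k,i,j) ↦ barlowPos a h s k i j` for every Hägg sequence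
(`barlowPos_injective`), and `V_LJ(√(a²P)) = (1/12)a⁻¹²P⁻⁶ − (1/6)a⁻⁶P⁻³`.
[cite: BlancLewin2015, §2.1 (23)]
-/

noncomputable section

namespace Literature.MathematicalPhysics.StatisticalMechanics

open Finset StackingSums

/-! ## Re-indexing a sum over the points of a configuration by `ℤ³` -/

/-- The indicator of the punctured point set, pulled back along an injection `ψ : ℤ³ → ℝ³` with
`ψ 0 = x` and range the point set, is the family `if v = 0 then 0 else F (ψ v)`. [folklore] -/
private theorem indicator_comp_eq_ite' {S : Set (EuclideanSpace ℝ (Fin 3))}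
    {x : EuclideanSpace ℝ (Fin 3)} {ψ : ℤ × ℤ × ℤ → EuclideanSpace ℝ (Fin 3)}
    (hinj : Function.Injective ψ) (h0 : ψ 0 = x) (hS : ∀ y, y ∈ S ↔ ∃ v, ψ v = y)
    (F : EuclideanSpace ℝ (Fin 3) → ℝ) (v : ℤ × ℤ × ℤ) :
    {y | y ∈ S ∧ y ≠ x}.indicator F (ψ v) = if v = 0 then 0 else F (ψ v) := by
  by_cases hv : v = 0
  · rw [if_pos hv, Set.indicator_of_notMem]
    simp [hv, h0]
  · rw [if_neg hv, Set.indicator_of_mem]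
    exact ⟨(hS _).2 ⟨v, rfl⟩, fun he => hv (hinj (he.trans h0.symm))⟩

/-- The support of that indicator lies in the range of `ψ`. [folklore] -/
private theorem support_indicator_subset_range' {S : Set (EuclideanSpace ℝ (Fin 3))}
    {x : EuclideanSpace ℝ (Fin 3)} {ψ : ℤ × ℤ × ℤ → EuclideanSpace ℝ (Fin 3)}
    (hS : ∀ y, y ∈ S ↔ ∃ v, ψ v = y) (F : EuclideanSpace ℝ (Fin 3) → ℝ) :
    Function.support ({y | y ∈ S ∧ y ≠ x}.indicator F) ⊆ Set.range ψ := fun y hy => by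
  obtain ⟨v, hv⟩ := (hS y).1 (Set.support_indicator_subset hy).1
  exact ⟨v, hv⟩

/-- **Re-indexing by `ℤ³`.** If `ψ : ℤ³ → ℝ³` is injective with `ψ 0 = x` and range `S`, then
`∑'_{y ∈ S, y ≠ x} F y = ∑'_{v ∈ ℤ³} (if v = 0 then 0 else F (ψ v))`. [folklore] -/
theorem tsum_points_eq_tsum_ite' {S : Set (EuclideanSpace ℝ (Fin 3))}
    {x : EuclideanSpace ℝ (Fin 3)} {ψ : ℤ × ℤ × ℤ → EuclideanSpace ℝ (Fin 3)}
    (hinj : Function.Injective ψ) (h0 : ψ 0 = x) (hS : ∀ y, y ∈ S ↔ ∃ v, ψ v = y)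
    (F : EuclideanSpace ℝ (Fin 3) → ℝ) :
    ∑' y : {y // y ∈ S ∧ y ≠ x}, F y.1 = ∑' v : ℤ × ℤ × ℤ, if v = 0 then 0 else F (ψ v) :=
  calc ∑' y : {y // y ∈ S ∧ y ≠ x}, F y.1
      = ∑' y, {y | y ∈ S ∧ y ≠ x}.indicator F y := tsum_subtype {y | y ∈ S ∧ y ≠ x} F
    _ = ∑' v, {y | y ∈ S ∧ y ≠ x}.indicator F (ψ v) :=
        (hinj.tsum_eq (support_indicator_subset_range' hS F)).symm
    _ = ∑' v : ℤ × ℤ × ℤ, if v = 0 then 0 else F (ψ v) :=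
        tsum_congr (indicator_comp_eq_ite' hinj h0 hS F)

/-! ## The Barlow point map -/

/-- **`(k,i,j) ↦ barlowPos a h s k i j` is injective** for `a, h ≠ 0` and every Hägg sequence `s`:
the third coordinate `k h` determines `k`, then the second determines `j`, then the first `i`.
[folklore] -/
theorem barlowPos_injective {a h : ℝ} (ha : a ≠ 0) (hh : h ≠ 0) (s : ℤ → ℤ) :
    Function.Injective fun v : ℤ × ℤ × ℤ => barlowPos a h s v.1 v.2.1 v.2.2 := by
  rintro ⟨k, i, j⟩ ⟨k', i', j'⟩ heq
  have e2 := congrArg (fun z : EuclideanSpace ℝ (Fin 3) => z 2) heq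
  have e1 := congrArg (fun z : EuclideanSpace ℝ (Fin 3) => z 1) heq
  have e0 := congrArg (fun z : EuclideanSpace ℝ (Fin 3) => z 0) heq
  simp only [barlowPos_apply_two, barlowPos_apply_one, barlowPos_apply_zero] at e0 e1 e2
  have hk : k = k' := by
    have : (k : ℝ) = k' := mul_right_cancel₀ hh e2
    exact_mod_cast this
  subst hk
  have h3 : (√3 : ℝ) ≠ 0 := by positivity
  have hj : j = j' := by
    have hc : a * √3 / 2 ≠ 0 := div_ne_zero (mul_ne_zero ha h3) two_ne_zero
    have : (j : ℝ) = j' := by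
      have := mul_left_cancel₀ hc e1
      linarith
    exact_mod_cast this
  subst hj
  have hi : i = i' := by
    have : (i : ℝ) = i' := by
      have := mul_left_cancel₀ ha e0
      linarith
    exact_mod_cast this
  subst hi
  rfl

/-- The point set of `fccPeriodicConfiguration` is the range of the point map. [folklore] -/
theorem mem_fcc_points_iff {a h : ℝ} (ha : a ≠ 0) (hh : h ≠ 0) (y : EuclideanSpace ℝ (Fin 3)) :
    y ∈ (fccPeriodicConfiguration ha hh).points ↔
      ∃ v : ℤ × ℤ × ℤ, barlowPos a h constHagg v.1 v.2.1 v.2.2 = y := by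
  rw [fccPeriodicConfiguration_points, fccStacking, mem_barlowStacking_iff]
  constructor
  · rintro ⟨k, i, j, rfl⟩
    exact ⟨(k, i, j), rfl⟩
  · rintro ⟨⟨k, i, j⟩, rfl⟩
    exact ⟨k, i, j, rfl⟩

/-- The point set of `hcpPeriodicConfiguration` is the range of the point map. [folklore] -/
theorem mem_hcp_points_iff {a h : ℝ} (ha : a ≠ 0) (hh : h ≠ 0) (y : EuclideanSpace ℝ (Fin 3)) :
    y ∈ (hcpPeriodicConfiguration ha hh).points ↔
      ∃ v : ℤ × ℤ × ℤ, barlowPos a h alternatingHagg v.1 v.2.1 v.2.2 = y := by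
  rw [hcpPeriodicConfiguration_points, hcpStacking, mem_barlowStacking_iff]
  constructor
  · rintro ⟨k, i, j, rfl⟩
    exact ⟨(k, i, j), rfl⟩
  · rintro ⟨⟨k, i, j⟩, rfl⟩
    exact ⟨k, i, j, rfl⟩

/-- The reflected parametrisation `(k,i,j) ↦ Φ(1−k,−i,−j)` of the hcp points. [folklore] -/
theorem mem_hcp_points_iff_reflected {a h : ℝ} (ha : a ≠ 0) (hh : h ≠ 0)
    (y : EuclideanSpace ℝ (Fin 3)) :
    y ∈ (hcpPeriodicConfiguration ha hh).points ↔
      ∃ v : ℤ × ℤ × ℤ, barlowPos a h alternatingHagg (1 - v.1) (-v.2.1) (-v.2.2) = y := by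
  rw [mem_hcp_points_iff ha hh]
  constructor
  · rintro ⟨⟨k, i, j⟩, rfl⟩
    exact ⟨(1 - k, -i, -j), by simp⟩
  · rintro ⟨⟨k, i, j⟩, rfl⟩
    exact ⟨(1 - k, -i, -j), rfl⟩

/-- The reflected parametrisation is injective. [folklore] -/
theorem hcp_reflected_injective {a h : ℝ} (ha : a ≠ 0) (hh : h ≠ 0) :
    Function.Injective fun v : ℤ × ℤ × ℤ =>
      barlowPos a h alternatingHagg (1 - v.1) (-v.2.1) (-v.2.2) := by
  rintro ⟨k, i, j⟩ ⟨k', i', j'⟩ heq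
  have := barlowPos_injective ha hh alternatingHagg (a₁ := (1 - k, -i, -j)) (a₂ := (1 - k', -i', -j')) heq
  simp only [Prod.mk.injEq, sub_right_inj, neg_inj] at this
  obtain ⟨rfl, rfl, rfl⟩ := this
  rfl

/-! ## The radicands -/

/-- **fcc radicand**: `|Φ(k,i,j)|² = a² fccForm (k,i,j) + k² h²` (label `L(k) = k`). [folklore] -/
theorem dist_fcc_zero_sq (a h : ℝ) (k i j : ℤ) :
    dist (barlowPos a h constHagg 0 0 0) (barlowPos a h constHagg k i j) ^ 2 =
      a ^ 2 * fccForm (k, i, j) + (k : ℝ) ^ 2 * h ^ 2 := by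
  have h3 : (√3 : ℝ) ^ 2 = 3 := Real.sq_sqrt (by norm_num)
  rw [dist_comm, dist_barlowPos_sq, haggLabel_zero, haggLabel_const]
  unfold fccForm
  push_cast
  linear_combination (a ^ 2 * ((j : ℝ) + k / 3) ^ 2 / 4) * h3

/-- **hcp radicand at the origin**: `|Φ(k,i,j)|² = a² hcpForm (k,i,j) + k² h²`. [folklore] -/
theorem dist_hcp_zero_sq (a h : ℝ) (k i j : ℤ) :
    dist (barlowPos a h alternatingHagg 0 0 0) (barlowPos a h alternatingHagg k i j) ^ 2 =
      a ^ 2 * hcpForm (k, i, j) + (k : ℝ) ^ 2 * h ^ 2 := by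
  have h3 : (√3 : ℝ) ^ 2 = 3 := Real.sq_sqrt (by norm_num)
  rw [dist_comm, dist_barlowPos_sq, haggLabel_zero, haggLabel_alternating]
  unfold hcpForm
  split_ifs
  · push_cast
    linear_combination (a ^ 2 * (j : ℝ) ^ 2 / 4) * h3
  · push_cast
    linear_combination (a ^ 2 * ((j : ℝ) + 1 / 3) ^ 2 / 4) * h3

/-- The hcp labels of the reflected layer index: `L(1 − k) = 1 − L(k)`. [folklore] -/
theorem haggLabel_alternating_one_sub (k : ℤ) :
    haggLabel alternatingHagg (1 - k) = if Even k then 1 else 0 := by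
  rw [haggLabel_alternating]
  have hpar : Even (1 - k) ↔ ¬ Even k := by
    rw [Int.even_sub]
    simp
  by_cases hk : Even k
  · rw [if_neg (fun h1 => (hpar.1 h1) hk), if_pos hk]
  · rw [if_pos (hpar.2 hk), if_neg hk]

/-- **hcp radicand at the second motif point** `b = Φ(1,0,0)`:
`|b − Φ(1−k,−i,−j)|² = a² hcpForm (k,i,j) + k² h²`. [folklore] -/
theorem dist_hcp_one_sq (a h : ℝ) (k i j : ℤ) :
    dist (barlowPos a h alternatingHagg 1 0 0)
        (barlowPos a h alternatingHagg (1 - k) (-i) (-j)) ^ 2 =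
      a ^ 2 * hcpForm (k, i, j) + (k : ℝ) ^ 2 * h ^ 2 := by
  have h3 : (√3 : ℝ) ^ 2 = 3 := Real.sq_sqrt (by norm_num)
  have h1 : haggLabel alternatingHagg 1 = 1 := by rw [haggLabel_alternating]; simp
  rw [dist_barlowPos_sq, h1, haggLabel_alternating_one_sub]
  unfold hcpForm
  split_ifs
  · push_cast
    linear_combination (a ^ 2 * (j : ℝ) ^ 2 / 4) * h3
  · push_cast
    linear_combination (a ^ 2 * ((j : ℝ) + 1 / 3) ^ 2 / 4) * h3

/-! ## The energies per particle as series -/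

/-- **The fcc energy per particle as an explicit series**: for `a, h ≠ 0` and any pair potential `V`,
`e(fcc(a,h)) = ½ ∑_{v ≠ 0} V(√(a² fccForm v + k² h²))` (one motif point; Blanc–Lewin 2015, (23)).
[cite: BlancLewin2015, §2.1 (23)] -/
theorem fcc_energyPerParticle_eq_tsum {a h : ℝ} (ha : a ≠ 0) (hh : h ≠ 0) (V : ℝ → ℝ) :
    (fccPeriodicConfiguration ha hh).energyPerParticle V =
      (1 / 2) * ∑' v : ℤ × ℤ × ℤ,
        if v = 0 then (0 : ℝ) else V (Real.sqrt (a ^ 2 * fccForm v + (v.1 : ℝ) ^ 2 * h ^ 2)) := by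
  have hd : ∀ v : ℤ × ℤ × ℤ, dist (barlowPos a h constHagg 0 0 0)
      (barlowPos a h constHagg v.1 v.2.1 v.2.2) =
        Real.sqrt (a ^ 2 * fccForm v + (v.1 : ℝ) ^ 2 * h ^ 2) := fun v => by
    rw [← dist_fcc_zero_sq a h v.1 v.2.1 v.2.2, Real.sqrt_sq dist_nonneg]
  have hT : ∑' y : {y // y ∈ (fccPeriodicConfiguration ha hh).points ∧
      y ≠ barlowPos a h constHagg 0 0 0}, V (dist (barlowPos a h constHagg 0 0 0) y.1) =
      ∑' v : ℤ × ℤ × ℤ, if v = 0 then (0 : ℝ) else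
        V (Real.sqrt (a ^ 2 * fccForm v + (v.1 : ℝ) ^ 2 * h ^ 2)) := by
    refine (tsum_points_eq_tsum_ite' (x := barlowPos a h constHagg 0 0 0)
      (barlowPos_injective ha hh constHagg) rfl (mem_fcc_points_iff ha hh)
      (fun y => V (dist (barlowPos a h constHagg 0 0 0) y))).trans ?_
    refine tsum_congr fun v => ?_
    split_ifs
    · rfl
    · exact congrArg V (hd v)
  have hmotif : (fccPeriodicConfiguration ha hh).motif = {barlowPos a h constHagg 0 0 0} := by
    show (Finset.range 1).image (fun m : ℕ => barlowPos a h constHagg m 0 0) = _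
    simp
  rw [PeriodicConfiguration.energyPerParticle, hmotif, Finset.sum_singleton, Finset.card_singleton,
    hT]
  norm_num

/-- **The hcp energy per particle as an explicit series**: for `a, h ≠ 0` and any pair potential
`V`, `e(hcp(a,h)) = ½ ∑_{v ≠ 0} V(√(a² hcpForm v + k² h²))` (both motif points have the same site
sum, by the point reflection `y ↦ b − y` of the stacking). [cite: BlancLewin2015, §2.1 (23)] -/
theorem hcp_energyPerParticle_eq_tsum {a h : ℝ} (ha : a ≠ 0) (hh : h ≠ 0) (V : ℝ → ℝ) :
    (hcpPeriodicConfiguration ha hh).energyPerParticle V =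
      (1 / 2) * ∑' v : ℤ × ℤ × ℤ,
        if v = 0 then (0 : ℝ) else V (Real.sqrt (a ^ 2 * hcpForm v + (v.1 : ℝ) ^ 2 * h ^ 2)) := by
  have hd0 : ∀ v : ℤ × ℤ × ℤ, dist (barlowPos a h alternatingHagg 0 0 0)
      (barlowPos a h alternatingHagg v.1 v.2.1 v.2.2) =
        Real.sqrt (a ^ 2 * hcpForm v + (v.1 : ℝ) ^ 2 * h ^ 2) := fun v => by
    rw [← dist_hcp_zero_sq a h v.1 v.2.1 v.2.2, Real.sqrt_sq dist_nonneg]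
  have hd1 : ∀ v : ℤ × ℤ × ℤ, dist (barlowPos a h alternatingHagg 1 0 0)
      (barlowPos a h alternatingHagg (1 - v.1) (-v.2.1) (-v.2.2)) =
        Real.sqrt (a ^ 2 * hcpForm v + (v.1 : ℝ) ^ 2 * h ^ 2) := fun v => by
    rw [← dist_hcp_one_sq a h v.1 v.2.1 v.2.2, Real.sqrt_sq dist_nonneg]
  have hΨ0 : (fun v : ℤ × ℤ × ℤ => barlowPos a h alternatingHagg (1 - v.1) (-v.2.1) (-v.2.2)) 0 =
      barlowPos a h alternatingHagg 1 0 0 := by simp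
  have hT0 : ∑' y : {y // y ∈ (hcpPeriodicConfiguration ha hh).points ∧
      y ≠ barlowPos a h alternatingHagg 0 0 0},
        V (dist (barlowPos a h alternatingHagg 0 0 0) y.1) =
      ∑' v : ℤ × ℤ × ℤ, if v = 0 then (0 : ℝ) else
        V (Real.sqrt (a ^ 2 * hcpForm v + (v.1 : ℝ) ^ 2 * h ^ 2)) := by
    refine (tsum_points_eq_tsum_ite' (x := barlowPos a h alternatingHagg 0 0 0)
      (barlowPos_injective ha hh alternatingHagg) rfl (mem_hcp_points_iff ha hh)
      (fun y => V (dist (barlowPos a h alternatingHagg 0 0 0) y))).trans ?_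
    refine tsum_congr fun v => ?_
    split_ifs
    · rfl
    · exact congrArg V (hd0 v)
  have hT1 : ∑' y : {y // y ∈ (hcpPeriodicConfiguration ha hh).points ∧
      y ≠ barlowPos a h alternatingHagg 1 0 0},
        V (dist (barlowPos a h alternatingHagg 1 0 0) y.1) =
      ∑' v : ℤ × ℤ × ℤ, if v = 0 then (0 : ℝ) else
        V (Real.sqrt (a ^ 2 * hcpForm v + (v.1 : ℝ) ^ 2 * h ^ 2)) := by
    refine (tsum_points_eq_tsum_ite' (x := barlowPos a h alternatingHagg 1 0 0)
      (hcp_reflected_injective ha hh) hΨ0 (mem_hcp_points_iff_reflected ha hh)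
      (fun y => V (dist (barlowPos a h alternatingHagg 1 0 0) y))).trans ?_
    refine tsum_congr fun v => ?_
    split_ifs
    · rfl
    · exact congrArg V (hd1 v)
  have key : ∀ x ∈ (hcpPeriodicConfiguration ha hh).motif,
      ∑' y : {y // y ∈ (hcpPeriodicConfiguration ha hh).points ∧ y ≠ x}, V (dist x y.1) =
      ∑' v : ℤ × ℤ × ℤ, if v = 0 then (0 : ℝ) else
        V (Real.sqrt (a ^ 2 * hcpForm v + (v.1 : ℝ) ^ 2 * h ^ 2)) := by
    intro x hx
    have hx' : x ∈ (Finset.range 2).image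
        (fun m : ℕ => barlowPos a h alternatingHagg m 0 0) := hx
    simp only [Finset.mem_image, Finset.mem_range] at hx'
    obtain ⟨m, hm, rfl⟩ := hx'
    rcases (show m = 0 ∨ m = 1 by omega) with rfl | rfl
    · exact hT0
    · exact hT1
  have hc : (((hcpPeriodicConfiguration ha hh).motif.card : ℕ) : ℝ) ≠ 0 :=
    Nat.cast_ne_zero.2 (Finset.card_pos.2 (hcpPeriodicConfiguration ha hh).motif_nonempty).ne'
  rw [PeriodicConfiguration.energyPerParticle, Finset.sum_congr rfl key, Finset.sum_const,
    nsmul_eq_mul, mul_inv, mul_assoc, inv_mul_cancel_left₀ hc, one_div]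

/-! ## Lennard-Jones: the energies through the inverse-power sums -/

/-- `V_LJ(√(a² P)) = (1/12) a⁻¹² P⁻⁶ − (1/6) a⁻⁶ P⁻³` for `P ≥ 0` and every `a` (only even powers
of `|a|` occur). [folklore] -/
theorem lennardJones_sqrt_sq_mul (a : ℝ) {P : ℝ} (hP : 0 ≤ P) :
    lennardJones (Real.sqrt (a ^ 2 * P)) =
      1 / 12 * (a⁻¹) ^ 12 * (P⁻¹) ^ 6 - 1 / 6 * (a⁻¹) ^ 6 * (P⁻¹) ^ 3 := by
  have hs : Real.sqrt (a ^ 2 * P) = |a| * Real.sqrt P := by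
    rw [Real.sqrt_mul (sq_nonneg a), Real.sqrt_sq_eq_abs]
  have hP2 : Real.sqrt P ^ 2 = P := Real.sq_sqrt hP
  unfold lennardJones
  rw [hs, mul_inv, mul_pow, mul_pow]
  have e12 : ((Real.sqrt P)⁻¹) ^ 12 = (P⁻¹) ^ 6 := by
    rw [show (12 : ℕ) = 2 * 6 from rfl, pow_mul, inv_pow, hP2]
  have e6 : ((Real.sqrt P)⁻¹) ^ 6 = (P⁻¹) ^ 3 := by
    rw [show (6 : ℕ) = 2 * 3 from rfl, pow_mul, inv_pow, hP2]
  have a12 : (|a|⁻¹) ^ 12 = (a⁻¹) ^ 12 := by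
    rw [inv_pow, inv_pow, show (12 : ℕ) = 2 * 6 from rfl, pow_mul, pow_mul, sq_abs]
  have a6 : (|a|⁻¹) ^ 6 = (a⁻¹) ^ 6 := by
    rw [inv_pow, inv_pow, show (6 : ℕ) = 2 * 3 from rfl, pow_mul, pow_mul, sq_abs]
  rw [e12, e6, a12, a6]; ring

/-- `fccForm ≥ 0` (a sum of squares: `(i + j/2 + k/2)² + (3/4)(j + k/3)²`). [folklore] -/
theorem fccForm_nonneg (v : ℤ × ℤ × ℤ) : 0 ≤ fccForm v := by
  obtain ⟨k, i, j⟩ := v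
  unfold fccForm
  nlinarith [sq_nonneg ((i : ℝ) + j / 2 + k / 2), sq_nonneg ((j : ℝ) + k / 3)]

/-- `hcpForm ≥ 0`. [folklore] -/
theorem hcpForm_nonneg (v : ℤ × ℤ × ℤ) : 0 ≤ hcpForm v := by
  obtain ⟨k, i, j⟩ := v
  rw [hcpForm_eq_stackForm]
  exact stackForm_nonneg (pattern_le_one _) i j

/-- **The fcc Lennard-Jones energy per particle through the lattice sums**:
`e(fcc(a, a c)) = ½ ((1/12) a⁻¹² L₁₂ᶠᶜᶜ(c) − (1/6) a⁻⁶ L₆ᶠᶜᶜ(c))` (`a, c ≠ 0`). [cite: Stillinger2001, §II] -/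
theorem fcc_lennardJones_energyPerParticle {a c : ℝ} (ha : a ≠ 0) (hc : c ≠ 0) :
    (fccPeriodicConfiguration ha (mul_ne_zero ha hc)).energyPerParticle lennardJones =
      1 / 2 * (1 / 12 * (a⁻¹) ^ 12 * fccInvPowSum 6 c - 1 / 6 * (a⁻¹) ^ 6 * fccInvPowSum 3 c) := by
  rw [fcc_energyPerParticle_eq_tsum]
  congr 1
  have hterm : ∀ v : ℤ × ℤ × ℤ, (if v = 0 then (0 : ℝ) else
      lennardJones (Real.sqrt (a ^ 2 * fccForm v + (v.1 : ℝ) ^ 2 * (a * c) ^ 2))) =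
      1 / 12 * (a⁻¹) ^ 12 * fccTerm 6 c v - 1 / 6 * (a⁻¹) ^ 6 * fccTerm 3 c v := by
    intro v
    unfold fccTerm
    split_ifs with hv
    · ring
    · have e : a ^ 2 * fccForm v + (v.1 : ℝ) ^ 2 * (a * c) ^ 2 =
          a ^ 2 * (fccForm v + (v.1 : ℝ) ^ 2 * c ^ 2) := by ring
      rw [e, lennardJones_sqrt_sq_mul a (by nlinarith [fccForm_nonneg v, sq_nonneg ((v.1:ℝ) * c)])]
  rw [tsum_congr hterm]
  have h6 := fccTerm_summable (n := 6) (by norm_num) hc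
  have h3 := fccTerm_summable (n := 3) (by norm_num) hc
  rw [(h6.mul_left _).tsum_sub (h3.mul_left _), tsum_mul_left, tsum_mul_left]
  rfl

/-- **The hcp Lennard-Jones energy per particle through the lattice sums**:
`e(hcp(a, a c)) = ½ ((1/12) a⁻¹² L₁₂ʰᶜᵖ(c) − (1/6) a⁻⁶ L₆ʰᶜᵖ(c))` (`a, c ≠ 0`). [cite: Stillinger2001, §II] -/
theorem hcp_lennardJones_energyPerParticle {a c : ℝ} (ha : a ≠ 0) (hc : c ≠ 0) :
    (hcpPeriodicConfiguration ha (mul_ne_zero ha hc)).energyPerParticle lennardJones =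
      1 / 2 * (1 / 12 * (a⁻¹) ^ 12 * hcpInvPowSum 6 c - 1 / 6 * (a⁻¹) ^ 6 * hcpInvPowSum 3 c) := by
  rw [hcp_energyPerParticle_eq_tsum]
  congr 1
  have hterm : ∀ v : ℤ × ℤ × ℤ, (if v = 0 then (0 : ℝ) else
      lennardJones (Real.sqrt (a ^ 2 * hcpForm v + (v.1 : ℝ) ^ 2 * (a * c) ^ 2))) =
      1 / 12 * (a⁻¹) ^ 12 * hcpTerm 6 c v - 1 / 6 * (a⁻¹) ^ 6 * hcpTerm 3 c v := by
    intro v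
    unfold hcpTerm
    split_ifs with hv
    · ring
    · have e : a ^ 2 * hcpForm v + (v.1 : ℝ) ^ 2 * (a * c) ^ 2 =
          a ^ 2 * (hcpForm v + (v.1 : ℝ) ^ 2 * c ^ 2) := by ring
      rw [e, lennardJones_sqrt_sq_mul a (by nlinarith [hcpForm_nonneg v, sq_nonneg ((v.1:ℝ) * c)])]
  rw [tsum_congr hterm]
  have h6 := hcpTerm_summable (n := 6) (by norm_num) hc
  have h3 := hcpTerm_summable (n := 3) (by norm_num) hc
  rw [(h6.mul_left _).tsum_sub (h3.mul_left _), tsum_mul_left, tsum_mul_left]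
  rfl

end Literature.MathematicalPhysics.StatisticalMechanics

end
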